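import Literature.NumberTheory.Rogawski1990.LocalUnitaryRankTwoHilbertSection            -- FILE A (this seat): the explicit element `[[0, (σk)⁻¹], [k, t]]` and the Hilbert-90 chart
import Literature.NumberTheory.Rogawski1990.LocalNormFibreNonsplit                      -- ★ `IsLocalNormPair.charpoly_eq`, `IsLocalGRegular.separable_mul ∕ _finCharpolyTwo`, `charpoly_endoEmbLocal`
import Literature.NumberTheory.Rogawski1990.UnitOrbitalIntegralInertValueTHOfKappa       -- ★ `trace_det_of_isLocalNormPair` (`tr x = tr g + u`, `det x = det g · u` on a matching pair)
import Literature.NumberTheory.Rogawski1990.LocalTransferUnmatchedLocus                 -- ★ `compactSpace_cmDatum_local_one_of_smul_eq` (`U(Φ₁)(L⁺_v)` compact at a non-split place)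
import Literature.NumberTheory.Automorphic.UnitaryGroupOfFormAdelicTopology             -- ★ `isClosed_unitaryGroupOfForm`
import Literature.NumberTheory.Automorphic.AdicCompletionCompact                        -- ★ `properSpace_adicCompletion`
import HarnessLib

/-!
# Bounded representatives of the NORM FIBRES of `H_v = U(Φ₂) × U(Φ₁)` over a compact subset of `U(Φ₃)(L⁺_v)` at a non-split place
# (Rogawski 1990 §5.4 p. 78 «three stable conjugacy classes in `H` which transfer to `γ₀`»; §3.1)

Topic `NumberTheory/Rogawski1990`; namespace `Literature.NumberTheory.Rogawski1990`.  THEOREMS ONLY (no definition, no instance, no notation, no named fact,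
no `sorry`).  Cell `pub/hodgecm-mathlib`, crux H413 = `stmt-HodgeConjecture-24833` (lane `--supports`), line LH6 «StCharTS», datum-road slice S13c «UP-DOM ⟸ UP-DEF»
(map owner LH6-p01 (g4); seat LH4-p01 (g5)); FILE B of three (A = `LocalUnitaryRankTwoHilbertSection`, C = `Summits/…/Theorems/F0P3cStCharTSUpDom`).  The sibling
★ `LocalNormFibreNonsplit` proves that at most THREE `H_v`-stable classes of `G`-regular elements match a given class of `U(H′)(L⁺_v)` (one per admissible value of the
`U(1)`-slot); this file proves that over a COMPACT set of targets the matching classes have representatives in ONE COMPACT subset of `H_v` — what Lemma 12.5.1's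
class function `α^G = D_G⁻¹ Σ_s τ D_H κ α(s)` (the `up` field of the §12.5 datum) needs in order to be dominated by finitely many values of `D_H·α` on a compact
set (FILE C).  HONEST LABEL: HC_CM is proved only modulo the 7 printed citations (2 remaining: hLiu418 = `stmt-HodgeConjecture-24832`, h413 =
`stmt-HodgeConjecture-24833`) until rung 0 closes; unconditional local algebra and topology, count-neutral.

THE MATHEMATICS.  `K ⊆ U(Φ₃)(L⁺_v)` compact ⇒ `‖(tr x)_w‖ ≤ C_tr`, `‖(det x)_w‖ ≤ C_det` on `K`.  If `γ_H = (g₀, u)` is `G`-regular and matches `x ∈ K`, then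
`charpoly x = charpoly g₀ · (X − u)` (★), so `t := tr g₀ = tr x − u` and `det x = d·u` with `d := det g₀`, `‖d_w‖ = ‖u_w‖ = 1`; hence `‖t_w‖ ≤ C_tr + C_det`.
FILE A's element `g = [[0, (σk)⁻¹], [k, t]]` (chart `k` with `ε ≤ ‖k_w‖ ≤ C_k`) lies in `U(Φ₂)(L⁺_v)`, has the SAME characteristic polynomial as `g₀`
(separable), hence is `GL₂(R)`-conjugate to `g₀` (★ `exists_units_conj_eq_of_charpoly_eq_of_separable`) — i.e. `(g, u)` is STABLY CONJUGATE to `γ_H` and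
`G`-regular — and all entries of `g` and `g⁻¹` have `w`-norm `≤ B := max(C_tr + C_det, C_k, ε⁻¹)`.  The set of pairs `(h, u′) ∈ H_v` with `h`, `h⁻¹`
entry-bounded by `B` is COMPACT (§5: closed-embedding pull-back of a product of closed balls along `U(Φ₂) ↪ GL₂(R) ↪ M₂(R) × M₂(R)ᵒᵖ`, times the compact
`U(Φ₁)(L⁺_v)`).  Main theorem `exists_isCompact_normFibre_reps` (§6).

## References
* [Rogawski1990] J. D. Rogawski, *Automorphic Representations of Unitary Groups in Three Variables*, Ann. of Math. Stud. 123 (1990): §5.4 p. 78; §3.1 p. 19; §4.3 p. 43;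
  §12.5 Lemma 12.5.1 p. 183.
* [PlatonovRapinchuk1994] V. Platonov, A. Rapinchuk, *Algebraic Groups and Number Theory* (1994), §3.3 (compactness in `p`-adic groups).
-/

set_option autoImplicit false

noncomputable section

open NumberField IsDedekindDomain Matrix Polynomial Topology
open scoped MatrixGroups
open Literature.NumberTheory.Automorphic Literature.NumberTheory.Automorphic.UnitaryGroup

namespace Literature.NumberTheory.Rogawski1990

variable (L : Type) [Field L] [NumberField L] [IsCMField L] (v : HeightOneSpectrum (𝓞 ↥(maximalRealSubfield L)))

/-! ## §5 The compact box of `H_v = U(Φ₂)(L⁺_v) × U(Φ₁)(L⁺_v)` cut out by entry bounds -/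

section Box

variable {L v}
variable (w : UnitaryGroup.PlacesOver L v) (hw : IsCMField.complexConj L • w.1 = w.1)

omit [IsCMField L] in
/-- The set of `2 × 2` matrices over `R` all of whose entries have norm `≤ B` at every place is compact. [cite: Rogawski1990, §5.4 p. 78; §3.1 p. 19] -/
theorem isCompact_matrixBox (B : ℝ) :
    IsCompact {M : Matrix (Fin 2) (Fin 2) (UnitaryGroup.LocalRing L v) | ∀ i j w', ‖M i j w'‖ ≤ B} := by
  haveI : ∀ w' : UnitaryGroup.PlacesOver L v, ProperSpace (w'.1.adicCompletion L) := fun w' => properSpace_adicCompletion L w'.1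
  have hpi : IsCompact (Set.pi Set.univ fun _ : Fin 2 => Set.pi Set.univ fun _ : Fin 2 =>
      Set.pi Set.univ fun w' : UnitaryGroup.PlacesOver L v => Metric.closedBall (0 : w'.1.adicCompletion L) B :
        Set (Matrix (Fin 2) (Fin 2) (UnitaryGroup.LocalRing L v))) :=
    isCompact_univ_pi fun _ => isCompact_univ_pi fun _ => isCompact_univ_pi fun w' => isCompact_closedBall _ _
  have hcl : IsClosed {M : Matrix (Fin 2) (Fin 2) (UnitaryGroup.LocalRing L v) | ∀ i j w', ‖M i j w'‖ ≤ B} := by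
    have hset : {M : Matrix (Fin 2) (Fin 2) (UnitaryGroup.LocalRing L v) | ∀ i j w', ‖M i j w'‖ ≤ B} =
        ⋂ i, ⋂ j, ⋂ w', {M : Matrix (Fin 2) (Fin 2) (UnitaryGroup.LocalRing L v) | ‖M i j w'‖ ≤ B} := by
      ext M; simp only [Set.mem_setOf_eq, Set.mem_iInter]
    rw [hset]
    refine isClosed_iInter fun i => isClosed_iInter fun j => isClosed_iInter fun w' => isClosed_le ?_ continuous_const
    exact (((continuous_apply w').comp ((continuous_apply j).comp (continuous_apply i))).norm :
      Continuous fun M : Matrix (Fin 2) (Fin 2) (UnitaryGroup.LocalRing L v) => ‖M i j w'‖)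
  refine hpi.of_isClosed_subset hcl fun M hM => ?_
  exact Set.mem_univ_pi.2 fun i => Set.mem_univ_pi.2 fun j => Set.mem_univ_pi.2 fun w' => by
    rw [Metric.mem_closedBall, dist_zero_right]; exact hM i j w'

include hw in
/-- **The compact box of `H_v`**: pairs whose `U(Φ₂)`-part and its inverse have all entries of norm `≤ B` (the `U(Φ₁)`-part is unconstrained —
`U(Φ₁)(L⁺_v)` is compact at a non-split place, ★ `compactSpace_cmDatum_local_one_of_smul_eq`). [cite: Rogawski1990, §5.4 p. 78; §3.1 p. 19] -/
theorem isCompact_entryBox (B : ℝ) :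
    IsCompact {s : (UnitaryGroup.cmDatum L 2 (Matrix.of fun i j : Fin 2 => if i.val + j.val + 1 = 2 then (1 : L) else 0)).Local v ×
        (UnitaryGroup.cmDatum L 1 (Matrix.of fun i j : Fin 1 => if i.val + j.val + 1 = 1 then (1 : L) else 0)).Local v |
      ∀ i j w', ‖(s.1.val.val : Matrix (Fin 2) (Fin 2) (UnitaryGroup.LocalRing L v)) i j w'‖ ≤ B ∧
        ‖((s.1.val)⁻¹.val : Matrix (Fin 2) (Fin 2) (UnitaryGroup.LocalRing L v)) i j w'‖ ≤ B} := by
  haveI : CompactSpace ((UnitaryGroup.cmDatum L 1 (Matrix.of fun i j : Fin 1 => if i.val + j.val + 1 = 1 then (1 : L) else 0)).Local v) :=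
    compactSpace_cmDatum_local_one_of_smul_eq L v w hw
  set box : Set (Matrix (Fin 2) (Fin 2) (UnitaryGroup.LocalRing L v)) := {M | ∀ i j w', ‖M i j w'‖ ≤ B} with hbox
  have hboxc : IsCompact box := isCompact_matrixBox B
  -- in `GL₂(R)`: the preimage of `box × op(box)` under the closed embedding `g ↦ (g, g⁻¹)`
  set CGL : Set (GL (Fin 2) (UnitaryGroup.LocalRing L v)) :=
    (Units.embedProduct (Matrix (Fin 2) (Fin 2) (UnitaryGroup.LocalRing L v))) ⁻¹' (box ×ˢ (MulOpposite.op '' box)) with hCGL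
  have hCGLc : IsCompact CGL :=
    Units.isClosedEmbedding_embedProduct.isCompact_preimage (hboxc.prod (hboxc.image MulOpposite.continuous_op))
  -- in `U(Φ₂)(L⁺_v)`: pull back along the closed embedding `Subtype.val`
  set CU : Set ((UnitaryGroup.cmDatum L 2 (Matrix.of fun i j : Fin 2 => if i.val + j.val + 1 = 2 then (1 : L) else 0)).Local v) :=
    (fun g => (g.val : GL (Fin 2) (UnitaryGroup.LocalRing L v))) ⁻¹' CGL with hCU
  have hCUc : IsCompact CU :=
    (isClosed_unitaryGroupOfForm (continuous_conjLocal L (IsCMField.complexConj L) v) (cmLocalForm L 2 v)).isClosedEmbedding_subtypeVal.isCompact_preimage hCGLc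
  have hprod : IsCompact (CU ×ˢ (Set.univ : Set ((UnitaryGroup.cmDatum L 1 (Matrix.of fun i j : Fin 1 => if i.val + j.val + 1 = 1 then (1 : L) else 0)).Local v))) :=
    hCUc.prod isCompact_univ
  suffices hEq : {s : (UnitaryGroup.cmDatum L 2 (Matrix.of fun i j : Fin 2 => if i.val + j.val + 1 = 2 then (1 : L) else 0)).Local v ×
        (UnitaryGroup.cmDatum L 1 (Matrix.of fun i j : Fin 1 => if i.val + j.val + 1 = 1 then (1 : L) else 0)).Local v |
      ∀ i j w', ‖(s.1.val.val : Matrix (Fin 2) (Fin 2) (UnitaryGroup.LocalRing L v)) i j w'‖ ≤ B ∧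
        ‖((s.1.val)⁻¹.val : Matrix (Fin 2) (Fin 2) (UnitaryGroup.LocalRing L v)) i j w'‖ ≤ B} =
      CU ×ˢ (Set.univ : Set ((UnitaryGroup.cmDatum L 1 (Matrix.of fun i j : Fin 1 => if i.val + j.val + 1 = 1 then (1 : L) else 0)).Local v)) by
    rw [hEq]; exact hprod
  ext s
  simp only [Set.mem_setOf_eq, Set.mem_prod, Set.mem_univ, and_true, hCU, Set.mem_preimage, hCGL, Units.embedProduct_apply,
    MulOpposite.op_injective.mem_set_image, hbox]
  exact ⟨fun h => ⟨fun i j w' => (h i j w').1, fun i j w' => (h i j w').2⟩, fun h i j w' => ⟨h.1 i j w', h.2 i j w'⟩⟩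

end Box

/-! ## §6 Coefficient bookkeeping on a matching pair and the assembly -/

section Assembly

variable {L v}

/-- **REP-H — BOUNDED REPRESENTATIVES OF THE NORM FIBRES OVER A COMPACT SET.**  At a non-split place `v`, for every compact `K ⊆ U(Φ₃)(L⁺_v)` there is a
compact `C ⊆ H_v = U(Φ₂)(L⁺_v) × U(Φ₁)(L⁺_v)` such that every `G`-regular `γ_H ∈ H_v` matching some `x ∈ K` is stably conjugate in `H_v` to a `G`-regular
`γ_H′ ∈ C` (the explicit representative `([[0, (σk)⁻¹],[k, tr g]], u)` of §3 with the chart `k` of §4; its entries are bounded in terms of `tr x`, `det x`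
and the chart constants, §5). [cite: Rogawski1990, §5.4 p. 78; §3.1 p. 19] -/
theorem exists_isCompact_normFibre_reps (hns : ∀ w : UnitaryGroup.PlacesOver L v, IsCMField.complexConj L • w.1 = w.1)
    (K : Set (Gqs L v)) (hK : IsCompact K) :
    ∃ C : Set ((UnitaryGroup.cmDatum L 2 (Matrix.of fun i j : Fin 2 => if i.val + j.val + 1 = 2 then (1 : L) else 0)).Local v ×
        (UnitaryGroup.cmDatum L 1 (Matrix.of fun i j : Fin 1 => if i.val + j.val + 1 = 1 then (1 : L) else 0)).Local v),
      IsCompact C ∧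
      ∀ s, IsLocalGRegular L v s → (∃ x ∈ K, IsLocalNormPair L (qsForm L) v s x) →
        ∃ s' ∈ C, IsLocalGRegular L v s' ∧ IsLocalStablyConjH L v s s' := by
  haveI : Algebra.IsQuadraticExtension ↥(maximalRealSubfield L) L := IsCMField.isQuadraticExtension L
  obtain ⟨w⟩ := UnitaryGroup.PlacesOver.nonempty L v
  have hw := hns w
  haveI : Subsingleton (UnitaryGroup.PlacesOver L v) :=
    PlacesOver.subsingleton_of_smul_eq (IsCMField.complexConj L) (IsCMField.complexConj_ne_one L) w hw
  set σ := conjLocal L (IsCMField.complexConj L) v with hσ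
  -- bounds on `K`: `‖(tr x)_w‖ ≤ Ctr`, `‖(det x)_w‖ ≤ Cdet`
  have hcont : Continuous fun x : Gqs L v => (x.val : GL (Fin 3) (UnitaryGroup.LocalRing L v)).val :=
    Units.continuous_val.comp continuous_subtype_val
  obtain ⟨Ctr, hCtr⟩ := hK.exists_bound_of_continuousOn
    (f := fun x : Gqs L v => (x.val : GL (Fin 3) (UnitaryGroup.LocalRing L v)).val.trace w)
    (((continuous_apply w).comp hcont.matrix_trace).continuousOn)
  obtain ⟨Cdet, hCdet⟩ := hK.exists_bound_of_continuousOn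
    (f := fun x : Gqs L v => (x.val : GL (Fin 3) (UnitaryGroup.LocalRing L v)).val.det w)
    (((continuous_apply w).comp hcont.matrix_det).continuousOn)
  obtain ⟨ε, Ck, hε, hchart⟩ := exists_hilbert90_chart_constants w hw
  set B : ℝ := max (Ctr + Cdet) (max Ck ε⁻¹) with hB
  have hB1 : Ctr + Cdet ≤ B := le_max_left _ _
  have hB2 : Ck ≤ B := (le_max_left _ _).trans (le_max_right _ _)
  have hB3 : ε⁻¹ ≤ B := (le_max_right _ _).trans (le_max_right _ _)
  have hB0 : 0 ≤ B := (inv_pos.2 hε).le.trans hB3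
  refine ⟨_, isCompact_entryBox w hw B, ?_⟩
  rintro s hs ⟨x, hxK, hmatch⟩
  -- the entries and invariants of `g₀ = s.1`
  obtain ⟨e00, e01, e10, e11⟩ := entries_of_mem_local_two L v (s.1.val : GL (Fin 2) (UnitaryGroup.LocalRing L v)) s.1.2
  set M : Matrix (Fin 2) (Fin 2) (UnitaryGroup.LocalRing L v) := (s.1.val : GL (Fin 2) (UnitaryGroup.LocalRing L v)).val with hM
  set t : UnitaryGroup.LocalRing L v := M 0 0 + M 1 1 with ht'
  set d : UnitaryGroup.LocalRing L v := M 0 0 * M 1 1 - M 0 1 * M 1 0 with hd'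
  have hd : σ d * d = 1 := conj_det_mul_det_eq_one_of_entries_two e00 e01 e10 e11
  have ht : σ t * d = t := conj_trace_mul_det_eq_trace_of_entries_two e00 e01 e10 e11
  have htM : M.trace = t := Matrix.trace_fin_two M
  have hdM : M.det = d := Matrix.det_fin_two M
  obtain ⟨k, hk, hku, hkε, hkC⟩ := hchart d hd
  have hσku : IsUnit (σ k) := hku.map σ
  obtain ⟨g, hgmem, hgval, hginv, hgtr, hgdet⟩ := exists_mem_local_two_of_invariants t d k hd ht hk hσku
  -- same characteristic polynomial
  have hq : (g.val).charpoly = M.charpoly := by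
    rw [Matrix.charpoly_fin_two, Matrix.charpoly_fin_two, hgtr, hgdet, htM, hdM]
  -- norm facts at `w`
  have hdn : ‖d w‖ = 1 := norm_apply_eq_one_of_conj_mul_self w hw hd
  have hσdn : ‖conjLocal L (IsCMField.complexConj L) v d w‖ = 1 := by rw [norm_conjLocal_apply w hw, hdn]
  obtain ⟨htr, hdet⟩ := trace_det_of_isLocalNormPair L v (qsForm L) s x hmatch
  have htr' : M.trace = (x.val : GL (Fin 3) (UnitaryGroup.LocalRing L v)).val.trace - finGammaTwo L v s := by
    rw [htr]; exact (add_sub_cancel_right _ _).symm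
  have hdet' : (x.val : GL (Fin 3) (UnitaryGroup.LocalRing L v)).val.det = M.det * finGammaTwo L v s := hdet
  have hun : ‖finGammaTwo L v s w‖ ≤ Cdet := by
    have h1 := congrArg (fun z : UnitaryGroup.LocalRing L v => ‖z w‖) hdet'
    simp only [Pi.mul_apply, norm_mul] at h1
    rw [hdM, hdn, one_mul] at h1
    rw [← h1]
    exact hCdet x hxK
  have htn : ‖t w‖ ≤ Ctr + Cdet := by
    rw [← htM, htr', Pi.sub_apply]
    exact (norm_sub_le _ _).trans (add_le_add (hCtr x hxK) hun)
  have hen : ‖(↑(hσku.unit⁻¹) : UnitaryGroup.LocalRing L v) w‖ ≤ ε⁻¹ := by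
    have h1 : (↑(hσku.unit⁻¹) : UnitaryGroup.LocalRing L v) * σ k = 1 := hσku.unit.inv_mul
    have h2 := congrArg (fun z : UnitaryGroup.LocalRing L v => ‖z w‖) h1
    simp only [Pi.mul_apply, norm_mul, Pi.one_apply, norm_one] at h2
    rw [norm_conjLocal_apply w hw] at h2
    have h3 : ‖(↑(hσku.unit⁻¹) : UnitaryGroup.LocalRing L v) w‖ = ‖k w‖⁻¹ := eq_inv_of_mul_eq_one_left h2
    rw [h3]
    exact inv_anti₀ hε hkε
  -- `G`-regularity and stable conjugacy of the representative `(g, u)`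
  have hχ : finCharpolyTwo L v ((⟨g, hgmem⟩, s.2) : (UnitaryGroup.cmDatum L 2 (Matrix.of fun i j : Fin 2 => if i.val + j.val + 1 = 2 then (1 : L) else 0)).Local v ×
      (UnitaryGroup.cmDatum L 1 (Matrix.of fun i j : Fin 1 => if i.val + j.val + 1 = 1 then (1 : L) else 0)).Local v) = finCharpolyTwo L v s := hq
  have hreg' : IsLocalGRegular L v ((⟨g, hgmem⟩, s.2) : (UnitaryGroup.cmDatum L 2 (Matrix.of fun i j : Fin 2 => if i.val + j.val + 1 = 2 then (1 : L) else 0)).Local v ×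
      (UnitaryGroup.cmDatum L 1 (Matrix.of fun i j : Fin 1 => if i.val + j.val + 1 = 1 then (1 : L) else 0)).Local v) := by
    have key : ∀ a : (UnitaryGroup.cmDatum L 2 (Matrix.of fun i j : Fin 2 => if i.val + j.val + 1 = 2 then (1 : L) else 0)).Local v ×
        (UnitaryGroup.cmDatum L 1 (Matrix.of fun i j : Fin 1 => if i.val + j.val + 1 = 1 then (1 : L) else 0)).Local v,
        IsLocalGRegular L v a ↔ IsRegularElt ((endoEmbLocal L v a).val : GL (Fin 3) (UnitaryGroup.LocalRing L v)) := fun a => Iff.rfl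
    rw [key, isRegularElt_iff, charpoly_endoEmbLocal, hχ]
    exact hs.separable_mul L v
  obtain ⟨c, hc⟩ := Literature.LinearAlgebra.Matrix.exists_units_conj_eq_of_charpoly_eq_of_separable
    (K := fun w' : UnitaryGroup.PlacesOver L v => w'.1.adicCompletion L)
    (s.1.val : GL (Fin 2) (UnitaryGroup.LocalRing L v)) g (hs.separable_finCharpolyTwo) hq
  refine ⟨(⟨g, hgmem⟩, s.2), ?_, hreg', ⟨isConj_iff.2 ⟨c, hc⟩, IsStablyConj.refl _⟩⟩
  -- the entry bounds
  intro i j w'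
  rw [Subsingleton.elim w' w]
  change ‖(g.val) i j w‖ ≤ B ∧ ‖((g⁻¹).val) i j w‖ ≤ B
  rw [hgval, hginv]
  fin_cases i <;> fin_cases j <;>
    simp only [Fin.zero_eta, Fin.mk_one, Fin.isValue, Matrix.of_apply, Matrix.cons_val_zero, Matrix.cons_val_one,
      Pi.zero_apply, norm_zero, Pi.mul_apply, Pi.neg_apply, norm_neg, norm_mul, hσdn, one_mul]
  · exact ⟨hB0, htn.trans hB1⟩
  · exact ⟨hen.trans hB3, hen.trans hB3⟩
  · exact ⟨hkC.trans hB2, hkC.trans hB2⟩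
  · exact ⟨htn.trans hB1, hB0⟩

end Assembly

end Literature.NumberTheory.Rogawski1990

end
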